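import Summits.Ventures.PercRepro.Night2TwoOneCell
import Summits.Ventures.PercRepro.Night2ThreeTwoNineTen

/-!
# PercRepro — **THE `(7, 5)` SHADOW ROW MODULO THE RESIDUES `(2, 0)`, `(2, 1)`: THE TWO-FAT-CLOSURE CLAUSE IN ITS
SPREAD REGIME IS CLOSED** (night-2, gen 28)

`shadowHall_seven_five_of_residuesZ''` (`Night2ThreeTwoNineTen`) reduced the `(7, 5)` shadow row to the residues
`h20′`, `h21′`; the `(2, 1)` residue `h21′` asked for (LI_G) when «two fat closures OR a thin member missing `3 … 6`
points».  `localShadowHall_two_one_five_fatClosures` (`Night2TwoOneCell`) settles the two-fat-closure clause whenever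
there are EXACTLY two fat closures and every thin member misses `2` or `≥ 7` points (at every `|V|`).  So the `(2, 1)`
residue shrinks to: «a thin member missing `3 … 6` points, OR at least three fat closures» —
**`shadowHall_seven_five_of_residuesZ'''`**, the row of record.
-/

namespace PercRepro.Shadow

open Finset PerFlat ThmH

section SevenFiveZ'''

variable {α' : Type} [DecidableEq α']

open scoped Classical in
/-- **THE `(7, 5)` SHADOW ROW FOR EVERY FINITE MATROID MODULO THE RESIDUES `(2, 0)`, `(2, 1)`, THE LATTER WITHOUT ITS
SPREAD TWO-FAT-CLOSURE CELLS**: the `(2, 1)` clause now reads «a thin member missing `3 … 6` points, or at least three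
fat closures». -/
theorem shadowHall_seven_five_of_residuesZ'''
    (h20 : ∀ (N : Matroid α') [N.Finite] (G : Finset α'), CellHyp N G →
      (gr N \ G).card = 2 → kColoops N G = 0 → FatMember N G 6 3 →
      (FatBasis N G 6 2 ∨ FatMember N G 6 2) →
      (2 ≤ (fatClosures N 5 G 2).card ∨
        ∃ B ∈ thinMembers N 5 G, 2 < (G \ clF N B).card ∧ (G \ clF N B).card < 5) →
      LocalShadowHall N 5 G)
    (h21 : ∀ (N : Matroid α') [N.Finite] (G : Finset α'), CellHyp N G →
      (gr N \ G).card = 2 → kColoops N G = 1 → FatMember N G 5 4 →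
      (FatBasis N G 5 3 ∨ FatMember N G 5 3) →
      ((∃ B ∈ thinMembers N 5 G, 2 < (G \ clF N B).card ∧ (G \ clF N B).card < 7) ∨
        3 ≤ (fatClosures N 5 G 2).card) →
      LocalShadowHall N 5 G)
    (M : Matroid α') [M.Finite] : ShadowHall M 7 5 (phiK 7 5) := by
  apply shadowHall_seven_five_of_residuesZ'' h20
  intro N _ G hcell hd hk hfm hfb hH
  rcases hH with hfat2 | hsp'
  · by_cases h3 : 3 ≤ (fatClosures N 5 G 2).card
    · exact h21 N G hcell hd hk hfm hfb (Or.inr h3)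
    · by_cases hsp : ∀ B ∈ thinMembers N 5 G, 2 < (G \ clF N B).card → 7 ≤ (G \ clF N B).card
      · exact localShadowHall_two_one_five_fatClosures hcell.2.2.2 hd hk hcell.1 hcell.2.1 hfat2 (by omega) hsp
      · push Not at hsp
        obtain ⟨B, hB, h1, h2⟩ := hsp
        exact h21 N G hcell hd hk hfm hfb (Or.inl ⟨B, hB, h1, h2⟩)
  · exact h21 N G hcell hd hk hfm hfb (Or.inl hsp')

end SevenFiveZ'''

end PercRepro.Shadow
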